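import Literature.MathematicalPhysics.QuantumFieldTheory.Balaban1983to89.Node00.BackgroundActionOfRecord
import Literature.MathematicalPhysics.QuantumFieldTheory.Balaban1983to89.B12Lemma4Models
import Literature.MathematicalPhysics.QuantumFieldTheory.Balaban1983to89.B10Eq68TorusRegularity

/-!
# `Node00.BackgroundCurrentShape` — the CURRENT `J_U = D*_U η⁻² π Im ∂U` of a configuration of record and the SECOND CLAUSE of
# [Balaban1987RG1] (1.2) p. 260 (`|J| < ε₀ on T`) as typed SHAPES: print's full space `U_k(ε₀)` at the record, in both printed currencies

statement-level skeleton of published theorems with citation tags; proofs where landed; nothing here is a claim about the Yang–Mills mass gap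

HONEST FRAMING.  DATA + SHAPE Props for NODE 00 stage ₈a (typing hand under director LINE №18, cut by the definer `pub-ymgap-node00-def-B`:
[NODE00-DEF-B-G0-HAND-WORD] ∕ [-PTR] ∕ [-PTR-2], cell INBOX l.9616 ∕ l.9623 ∕ l.9627).  EVERYTHING BY NAME over tree objects: the current is the tree's
(1.8) current `B12Eq18Current.current` (`π` onto `𝔤ᶜ = 𝔰𝔩(N, ℂ)` = `B12Lemma4Models.slProj`) at the `GL(N, ℂ)`-reading `unitsField ∘ toUField`
(`B10Eq27TorusAxialLog`) of an `SU(N)` configuration; (1.2)'s current clause is a named PREDICATE; with ₈a's class `bgReg` it is print's full `U_k(ε₀)`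
(= `Setup.RegularSpace` on `(U, J_U)`, definitionally); [Balaban1985Variational] (2)'s `𝔘_k({Ω_j}, ε₀)` at `Ω_j = T` is `B10Eq68TorusRegularity.InSpace`
BY NAME, its plaquette half IS `bgReg` (§4).  NOTHING of Bałaban's is asserted — NOT «`U_k(V)` satisfies `|J| < ε₀`» ([B11] Thm 1 (8)–(10)): the
DISPLAYED GAPS row G₈a-3 of ₈a, whose statement gets typed homes `UkCurrentSmall` ∕ `UkInSpaceB11` (§5, `Prop`s).  No definition of record touched
(append-only NEW module under ₈a's imports); counts unmoved (typed 28∕28 · discharged 1∕28); one finite `T⁴` programme at fixed `ε`; nothing here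
concerns the continuum, `ℝ⁴`, OS axioms, a mass gap or the Clay problem.  Seat `pub-ymgap-dag-n01-b` (g2), 2026-08-25.

THE PRINT (page images `run/shared/lean/pub/pub-balaban/b2b-balaban-ref1/pages/1987-cmp109-rg-I-small-field/…-p012-x2.png` = [I] p. 260;
`…/1985-cmp102-variational-background/…-p002-x2.png`, `…-p003-x2.png` = [B11] pp. 278–279, read as images by this seat).
* [I] = [Balaban1987RG1] (1.2) p. 260, verbatim: *«|U(∂p) − 1| = |(∂U)(p) − 1| < ε₀η², η = L^{−k}, p ∈ T,  |J| < ε₀ on T, J = D*_U η^{−2} π Im ∂U,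
  (1.2) with ε₀ sufficiently small. By Proposition 2 [12] this condition implies that |V(∂p′) − 1| < 2ε₀ for p′ ∈ T₁^{(k)}, and is implied by the
  condition on V, with 2ε₀ replaced by B₃⁻¹ε₀, see Theorem 1 [15].»*  ((1.8) p. 261: *«π denotes the projection … onto the algebra 𝔤ᶜ, and
  Im U = (1/2i)(U − U⁻¹)»*.)
* [B11] = [Balaban1985Variational] (2) p. 278, verbatim: *«|U(∂p) − 1| = |(∂U)(p) − 1| < ε₀L^{−2j} = ε₀η²(L^jη)^{−2} for p ∈ Ω_j, j = 0, 1, …, k,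
  |(D*_U ∂U)(b)| < ε₀L^{−2j}(L^jη)^{−1} = ε₀η²(L^jη)^{−3} for b ∈ Ω_j, (2)»*; p. 278 l. 8–9: *«The space 𝔘_k({Ω_j}, ε₀) is gauge invariant»*;
  (4)–(6) p. 278 = the gauge transformations `u = 1` on `𝔅_k`, the action `A^η`, the space `𝔘_k({Ω_j}, ε₀) ∩ 𝔅_k(𝔅_k, V)` — at the record ₈a's
  `UkExists`∕`Uk` over `bgReg`.  Thm 1 p. 279 (DISPLAYED — GAPS G₈a-1∕-2∕-3), verbatim: *«for an arbitrary configuration V satisfying (7) with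
  ε₁ ≤ a₁ there exists a minimal orbit in the space 𝔘_k({Ω_j}, B₃ε₁) ∩ 𝔅_k(𝔅_k, V). (8)»* — so (8) already puts the minimal orbit INSIDE
  `𝔘_k({Ω_j}, B₃ε₁)`; (9)–(10) p. 279 are the gauged regularity displays `|A|, |∇^η A|, ‖A‖_{1,β}, |∂^{η*}∂^η A|, |Δ^η A| < B·Mε₁(L^jη)^{−1,−2,−2−β,−3}`.
* [15] = [Balaban1985BackgroundPropagators] (3.11) p. 392 *«J = D*η⁻² Im ∂U»* = `B9Eq39Adjoint.J` (`π = id`); (1.8)∕(1.2) = its `π`-form.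

THE TYPING (carriers OF RECORD `GaugeField (F.P K) 0 (SU N)`, `η = η_k = (F.P K).eta k = L^{−k}` as in ₈a's `bgReg`; nothing re-declared).  §1 `cfgGL U
:= unitsField (toUField U)`, `gtGL u`.  §2 `currentOfRecord F N K k U := B12Eq18Current.current (slProj N) ((F.P K).eta k) (cfgGL N U)`; NORM = print's
operator norm `|X|` ([Balaban1985Averaging] (19)) = scope `Matrix.Norms.L2Operator` = the norm of `dist1` behind `PlaqSmall`∕`bgReg`.  §3 `CurrentSmall`,
`InUkClass := bgReg ∧ CurrentSmall` (FULL `U_k(ε₀)`; unfold with `mem_bgReg_iff`), `inUkClass_iff_regularSpace` (`Iff.rfl` to `Setup.RegularSpace`).  §4 `InUkClassB11 :=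
B10Eq68TorusRegularity.InSpace k (fun _ => univ) ε₀ η_k (toUField U)` ([B11] (2), all `j ≤ k`, no holes).  §5 `UkCurrentSmall`, `UkInSpaceB11` (G₈a-3).
WHAT IS PROVED (kernel; bookkeeping∕dictionary only).  `cfgGL_gaugeAct`; `trace_currentOfRecord` ([I] p. 262 «values in 𝔤ᶜ»); `currentOfRecord_gaugeAct`
(`J_{U^u}(b) = R(u(b₋)) J_U(b)`, [15] (3.30) ∕ [I] (1.10) — `B12Lemma4Models.current_gaugeU_su`); `norm_currentOfRecord_gaugeAct`; **[B11] p. 278 «The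
space 𝔘_k({Ω_j}, ε₀) is gauge invariant» at the record, both currencies**: `inUkClass_gaugeAct_iff`, `inUkClassB11_gaugeAct_iff`; **ALIGNMENT**
`regAt_univ_toUField_iff_mem_bgReg` ([B11] (2)'s scale-`k` plaquette clause at `Ω_k = T` IS `bgReg F N K k ε₀`: the same real threshold `ε₀·(L^k)⁻² =
ε₀·η_k²`), `InUkClassB11.mem_bgReg`, `inUkClassB11_iff` (`ε₀ ≥ 0`: `InUkClassB11 ↔ bgReg ∧ RegDivAt k univ ε₀ η_k`; `j < k` by level-monotonicity).
HONEST SCOPE ∕ NOT HERE.  (i) The two CURRENT clauses are two printed objects ((2): `D^{η*}_U ∂U` = `covDivT`; (1.2): `J = D^{η*} η⁻² π Im ∂U`), one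
space up to `O(1)` in `ε₀` in print ([I] p. 260 «2ε₀ … B₃⁻¹ε₀»); no comparison is claimed (`B9Eq39Adjoint.divP` vs `B10Eq68TorusRegularity.covDivT` are
typed independently).  (ii) No estimate: G₈a-3, [B11] Thm 1 (7)–(10), [I] (1.14)∕(1.16) stay displayed.  (iii) `D^{η*}J = 0`, `J* = J` not restated.
No `sorry`; no `Prop` placeholder beyond the SHAPES and the G₈a-3 names; no instance ∕ notation.
-/

noncomputable section

namespace Literature.MathematicalPhysics.QuantumFieldTheory.Balaban1983to89.Node00

open T4Continuum (T4Family)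
open B9Eq39Adjoint (R)
open B12RegularSpaces111 (gaugeU)
open B12RegularSpaces111SpecialUnitary (suModel)
open B12Lemma4Models (slProj)
open B10Eq27TorusAxialLog (suIncl toUField unitsField)
open B10Eq68TorusRegularity (RegAt InSpace2 RegPlaqAt RegDivAt InSpace)
open scoped Matrix.Norms.L2Operator

variable (F : T4Family) (N : ℕ) {P : Params} {j : ℕ}

/-! ## §1. Configurations of record read `GL(N, ℂ)`-valued — BY NAME through the tree's `SU(N) ≤ U(N) → M_N(ℂ)ˣ` -/

/-- A configuration of record `U : PBond P j → SU(N)` read as the `GL(N, ℂ)`-valued bond configuration `𝐔` of `B12Eq18Current`: the tree's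
`unitsField (toUField U)` (`B10Eq27TorusAxialLog`; [I] p. 252 «G … a Lie subgroup of a group of complex unitary matrices»). [cite: Balaban1987RG1, (1.10) p.262 (dictionary)] -/
@[reducible] def cfgGL (U : GaugeField P j (SU N)) : PBond P j → (Matrix (Fin N) (Fin N) ℂ)ˣ := unitsField (toUField U)

/-- The underlying matrix of `𝐔(b)` is the link variable `U(b)`. [cite: Balaban1987RG1, (1.10) p.262 (dictionary)] -/
@[simp] theorem coe_cfgGL (U : GaugeField P j (SU N)) (b : PBond P j) :
    ((cfgGL N U b : (Matrix (Fin N) (Fin N) ℂ)ˣ) : Matrix (Fin N) (Fin N) ℂ) = ((U b : SU N) : Matrix (Fin N) (Fin N) ℂ) := rfl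

/-- Every `𝐔(b)` lies in `G = SU(N) ≤ Gᶜ = SL(N, ℂ)` of the tree's `SU(N)` model. [cite: Balaban1987RG1, p.252 (dictionary)] -/
theorem cfgGL_mem_Gc (U : GaugeField P j (SU N)) (b : PBond P j) : cfgGL N U b ∈ (suModel N).Gc :=
  B12RegularSpaces111SpecialUnitary.suModel_G_le_Gc (show cfgGL N U b ∈ (suModel N).G from (U b).2)

/-- A gauge transformation of record read `GL(N, ℂ)`-valued (cf. `B10Eq68TorusRegularity.unitsField_gaugeAct`). [cite: Balaban1987RG1, (1.10) p.262 (dictionary)] -/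
def gtGL (u : GaugeTransf P j (SU N)) : Site P j → (Matrix (Fin N) (Fin N) ℂ)ˣ := fun x => Unitary.toUnits (suIncl (u x))

/-- Inverses are read pointwise. [cite: Balaban1987RG1, (1.10) p.262 (dictionary)] -/
theorem gtGL_inv (u : GaugeTransf P j (SU N)) (x : Site P j) : (gtGL N u x)⁻¹ = Unitary.toUnits (suIncl (u x)⁻¹) := by
  simp only [gtGL, map_inv]

/-! ## §2. The current `J_U = D^{η*}_U η⁻² π Im ∂U` of a configuration of record ([I] (1.2)∕(1.8); [B11] (28); [15] (3.11)) -/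

/-- **THE CURRENT OF A CONFIGURATION OF RECORD** — [I] (1.2)∕(1.8): `J_U(b) = (D^{η*}_U η⁻² π Im ∂U)(b)` on the finest torus of the `K`-th
approximation, `η = η_k = L^{−k}` (as in ₈a's `bgReg`), `π` = the traceless part `slProj N` (onto `𝔤ᶜ = 𝔰𝔩(N, ℂ)`), `Im U = (2i)⁻¹(U − U⁻¹)`,
`D^{η*}` of [15] (3.9): BY NAME `B12Eq18Current.current` at the `GL`-valued reading. [cite: Balaban1987RG1, (1.2) p.260] -/
def currentOfRecord (K k : ℕ) (U : GaugeField (F.P K) 0 (SU N)) : PBond (F.P K) 0 → Matrix (Fin N) (Fin N) ℂ :=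
  B12Eq18Current.current (slProj N) ((F.P K).eta k) (cfgGL N U)

/-- **`J` «has values in 𝔤ᶜ»** ([I] p. 262): `tr J_U(b) = 0` (`B12Eq18Current.current_mem_gc` in the tree's `SU(N)` model). [cite: Balaban1987RG1, (1.10) p.262] -/
theorem trace_currentOfRecord (K k : ℕ) (U : GaugeField (F.P K) 0 (SU N)) (b : PBond (F.P K) 0) :
    (currentOfRecord F N K k U b).trace = 0 :=
  B12RegularSpaces111SpecialUnitary.mem_suModel_gc.1
    (B12Eq18Current.current_mem_gc (suModel N) (slProj N) B12Lemma4Models.slProj_mem_suModel_gc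
      B12Lemma4Models.suModel_hgc_Gc _ (fun b => cfgGL_mem_Gc N U b) b)

variable [NeZero N]

/-- `SU(N) ≤ U(N)` intertwines the gauge actions of `Setup`. [cite: Balaban1985Averaging, (8) p.19 (dictionary)] -/
theorem toUField_gaugeAct (u : GaugeTransf P j (SU N)) (U : GaugeField P j (SU N)) :
    toUField (GaugeField.gaugeAct u U) = GaugeField.gaugeAct (fun x => suIncl (u x)) (toUField U) := by
  funext b
  simp only [toUField, GaugeField.gaugeAct, map_mul, map_inv]

/-- **`Setup`'s gauge action IS [I] (1.10)'s `𝐔 ↦ u₋𝐔u₊⁻¹` on the `GL`-valued reading** (`B12RegularSpaces111.gaugeU`). [cite: Balaban1987RG1, (1.10) p.262 (dictionary)] -/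
theorem cfgGL_gaugeAct (u : GaugeTransf P 0 (SU N)) (U : GaugeField P 0 (SU N)) :
    cfgGL N (GaugeField.gaugeAct u U) = gaugeU (gtGL N u) (cfgGL N U) := by
  unfold cfgGL
  rw [toUField_gaugeAct, B10Eq68TorusRegularity.unitsField_gaugeAct]
  rfl

/-- **Gauge covariance of the current** ([15] (3.30) `J^u = R(u)J`; [I] (1.10)): `J_{U^u}(b) = u(b₋) J_U(b) u(b₋)⁻¹` for `SU(N)`-valued `u` —
`B12Lemma4Models.current_gaugeU_su` BY NAME. [cite: Balaban1987RG1, (1.10) p.262] -/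
theorem currentOfRecord_gaugeAct (K k : ℕ) (u : GaugeTransf (F.P K) 0 (SU N)) (U : GaugeField (F.P K) 0 (SU N)) (b : PBond (F.P K) 0) :
    currentOfRecord F N K k (GaugeField.gaugeAct u U) b = R (gtGL N u b.src) (currentOfRecord F N K k U b) := by
  unfold currentOfRecord
  rw [cfgGL_gaugeAct]
  exact B12Lemma4Models.current_gaugeU_su _ _ _ _

/-- The operator norm of the current is gauge invariant: `|u J u⁻¹| = |J|` (unitary conjugation is a C⋆-norm isometry). [cite: Balaban1985Variational, p.278 (bookkeeping)] -/
theorem norm_currentOfRecord_gaugeAct (K k : ℕ) (u : GaugeTransf (F.P K) 0 (SU N)) (U : GaugeField (F.P K) 0 (SU N))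
    (b : PBond (F.P K) 0) :
    ‖currentOfRecord F N K k (GaugeField.gaugeAct u U) b‖ = ‖currentOfRecord F N K k U b‖ := by
  have h1 : ((gtGL N u b.src : (Matrix (Fin N) (Fin N) ℂ)ˣ) : Matrix (Fin N) (Fin N) ℂ) ∈ unitary (Matrix (Fin N) (Fin N) ℂ) :=
    (suIncl (u b.src)).2
  have h2 : (((gtGL N u b.src)⁻¹ : (Matrix (Fin N) (Fin N) ℂ)ˣ) : Matrix (Fin N) (Fin N) ℂ) ∈ unitary (Matrix (Fin N) (Fin N) ℂ) := by
    rw [gtGL_inv]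
    exact (suIncl (u b.src)⁻¹).2
  rw [currentOfRecord_gaugeAct, B9Eq39Adjoint.R_def, mul_assoc, CStarRing.norm_mem_unitary_mul _ h1,
    CStarRing.norm_mul_mem_unitary _ h2]

/-! ## §3. [I] (1.2): the current clause as a SHAPE, and print's full space `U_k(ε₀)` -/

/-- **SHAPE — the second clause of [I] (1.2)**: `|J| < ε₀ on T` (operator norm, every bond of the finest torus) for the current `J_U` at step `k`.
A PREDICATE; nothing asserts it of any configuration. [cite: Balaban1987RG1, (1.2) p.260] -/
def CurrentSmall (K k : ℕ) (ε₀ : ℝ) (U : GaugeField (F.P K) 0 (SU N)) : Prop :=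
  ∀ b : PBond (F.P K) 0, ‖currentOfRecord F N K k U b‖ < ε₀

/-- **PRINT'S FULL SPACE `U_k(ε₀)` OF [I] (1.2)**: ₈a's class `bgReg F N K k ε₀` (`|U(∂p) − 1| < ε₀η²`) AND the current clause `CurrentSmall`
(₈a minimises over `bgReg` alone, its D-defB-1). [cite: Balaban1987RG1, (1.2) p.260] -/
def InUkClass (K k : ℕ) (ε₀ : ℝ) (U : GaugeField (F.P K) 0 (SU N)) : Prop :=
  U ∈ bgReg F N K k ε₀ ∧ CurrentSmall F N K k ε₀ U

variable {F N}

/-- **DICTIONARY TO THE TREE'S TYPED (1.2)**: membership in `U_k(ε₀)` IS membership of the pair `(U, J_U)` in `Setup.RegularSpace (F.P K) k ε₀` ((1.2)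
on pairs, free second variable as in [I] (1.9)) — definitionally. [cite: Balaban1987RG1, (1.2) p.260 (dictionary)] -/
theorem inUkClass_iff_regularSpace {K k : ℕ} {ε₀ : ℝ} {U : GaugeField (F.P K) 0 (SU N)} :
    InUkClass F N K k ε₀ U ↔
      (⟨U, currentOfRecord F N K k U⟩ : FieldPair (F.P K) 0 (SU N) (Matrix (Fin N) (Fin N) ℂ)) ∈ RegularSpace (F.P K) k ε₀ := Iff.rfl

/-- The current clause is gauge invariant. [cite: Balaban1985Variational, p.278] -/
theorem currentSmall_gaugeAct_iff {K k : ℕ} {ε₀ : ℝ} (u : GaugeTransf (F.P K) 0 (SU N)) (U : GaugeField (F.P K) 0 (SU N)) :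
    CurrentSmall F N K k ε₀ (GaugeField.gaugeAct u U) ↔ CurrentSmall F N K k ε₀ U := by
  simp only [CurrentSmall, norm_currentOfRecord_gaugeAct]

/-- **«The space 𝔘_k({Ω_j}, ε₀) is gauge invariant»** ([B11] p. 278), (1.2)-form at the record, every `SU(N)`-valued `u` (plaquette clause:
`B12GaugeOrbits021.plaqSmall_gaugeAct_iff'`). [cite: Balaban1985Variational, p.278] -/
theorem inUkClass_gaugeAct_iff {K k : ℕ} {ε₀ : ℝ} (u : GaugeTransf (F.P K) 0 (SU N)) (U : GaugeField (F.P K) 0 (SU N)) :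
    InUkClass F N K k ε₀ (GaugeField.gaugeAct u U) ↔ InUkClass F N K k ε₀ U := by
  simp only [InUkClass, mem_bgReg_iff, B12GaugeOrbits021.plaqSmall_gaugeAct_iff', currentSmall_gaugeAct_iff]

/-! ## §4. [B11] (2): the full space `𝔘_k({Ω_j}, ε₀)` at `Ω_j = T` — BY NAME `B10Eq68TorusRegularity.InSpace`; alignment with ₈a's `bgReg` -/

variable (F N)

/-- **[B11] (2)'s SPACE `𝔘_k({Ω_j}, ε₀)` IN THE NO-HOLES CASE `Ω_j = T` (j ≤ k)** for a configuration of record: the tree's FULL typed (2)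
`B10Eq68TorusRegularity.InSpace k Ω ε₀ η` (both clauses, all `j ≤ k`; current clause «|(D*_U ∂U)(b)| < ε₀L^{−2j}(L^jη)^{−1}» on `covDivT η`) at
`Ω := fun _ => univ`, `η := η_k = (F.P K).eta k = L^{−k}` ([B11] (5) «η = L^{−k}»; by `B10Eq68TorusRegularity.regDivAt_iff_unit` the clause is in fact
`η`-free), through `SU(N) ≤ U(N)` (`toUField`).  NB: (2) bounds `D^{η*}_U ∂U` itself, [I] (1.2) bounds `J = D^{η*} η⁻² π Im ∂U` — one space up to `O(1)` in
`ε₀` in print; the comparison is `Node00.BackgroundCurrentCompare` (`𝔘_k({T}, ε₀) ⊆ U_k(2ε₀)`). [cite: Balaban1985Variational, (2) p.278] -/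
def InUkClassB11 (K k : ℕ) (ε₀ : ℝ) (U : GaugeField (F.P K) 0 (SU N)) : Prop :=
  InSpace k (fun _ => (Set.univ : Set (Site (F.P K) 0))) ε₀ ((F.P K).eta k) (toUField U)

variable {F N}

/-- The threshold letters agree: `(L^k)⁻² = η_k²` (`Params.eta k = (L⁻¹)^k`). [cite: Balaban1987RG1, (1.2) p.260 (bookkeeping)] -/
theorem inv_pow_sq_eq_eta_sq (P : Params) (k : ℕ) : (((P.L : ℝ) ^ k)⁻¹) ^ 2 = P.eta k ^ 2 := by
  rw [Params.eta, ← inv_pow]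

/-- **ALIGNMENT OF THE PLAQUETTE HALVES**: [B11] (2)'s scale-`k` plaquette clause at `Ω_k = T` IS ₈a's class `bgReg F N K k ε₀` (the SAME real
threshold `ε₀·(L^k)⁻² = ε₀·η_k²`, the same `dist1`: `dist1_plaqHol_toUField`). [cite: Balaban1985Variational, (2) p.278] -/
theorem regAt_univ_toUField_iff_mem_bgReg {K k : ℕ} {ε₀ : ℝ} (U : GaugeField (F.P K) 0 (SU N)) :
    RegAt k (Set.univ : Set (Site (F.P K) 0)) ε₀ (toUField U) ↔ U ∈ bgReg F N K k ε₀ := by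
  rw [mem_bgReg_iff, PlaqSmall, ← inv_pow_sq_eq_eta_sq]
  refine ⟨fun h q => ?_, fun h q _ => ?_⟩
  · rw [← B10Eq27TorusAxialLog.dist1_plaqHol_toUField]
    exact h q (B10Eq68TorusRegularity.touches_of_src_mem (Set.mem_univ _))
  · rw [B10Eq27TorusAxialLog.dist1_plaqHol_toUField]
    exact h q

/-- A member of [B11] (2)'s space at `Ω_j = T` lies in ₈a's class (unconditionally). [cite: Balaban1985Variational, (2) p.278] -/
theorem InUkClassB11.mem_bgReg {K k : ℕ} {ε₀ : ℝ} {U : GaugeField (F.P K) 0 (SU N)} (h : InUkClassB11 F N K k ε₀ U) :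
    U ∈ bgReg F N K k ε₀ :=
  (regAt_univ_toUField_iff_mem_bgReg U).1 ((B10Eq68TorusRegularity.inSpace2_of_inSpace_toUField h).regAt le_rfl)

/-- **[B11] (2) AT `Ω_j = T` = ₈a's `bgReg` ∧ THE SCALE-`k` DIVERGENCE CLAUSE** (`ε₀ ≥ 0`; the clauses `j < k` follow from `j = k` by the tree's
level-monotonicity = [Balaban1985RegularSpaces] p. 77 «if these conditions hold for some j = l, then they hold for all j < l»). [cite: Balaban1985Variational, (2) p.278] -/
theorem inUkClassB11_iff {K k : ℕ} {ε₀ : ℝ} (hε : 0 ≤ ε₀) (U : GaugeField (F.P K) 0 (SU N)) :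
    InUkClassB11 F N K k ε₀ U ↔
      U ∈ bgReg F N K k ε₀ ∧ RegDivAt k (Set.univ : Set (Site (F.P K) 0)) ε₀ ((F.P K).eta k) (cfgGL N U) := by
  have hη : 0 < (F.P K).eta k := pow_pos (inv_pos.mpr (Nat.cast_pos.mpr (F.P K).L_pos)) k
  refine ⟨fun h => ⟨h.mem_bgReg, h.regDivAt le_rfl⟩, fun h j hj => ⟨?_, h.2.of_le_level hj hε hη⟩⟩
  have hk : RegPlaqAt k (Set.univ : Set (Site (F.P K) 0)) ε₀ (unitsField (toUField U)) :=
    (B10Eq68TorusRegularity.regPlaqAt_unitsField_iff _).2 ((regAt_univ_toUField_iff_mem_bgReg U).2 h.1)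
  exact hk.of_le_level hj hε

/-- **«The space 𝔘_k({Ω_j}, ε₀) is gauge invariant»** ([B11] p. 278), (2)-form at the record, every `SU(N)`-valued `u` —
`B10Eq68TorusRegularity.inSpace_gaugeAct_iff` BY NAME. [cite: Balaban1985Variational, p.278] -/
theorem inUkClassB11_gaugeAct_iff {K k : ℕ} {ε₀ : ℝ} (u : GaugeTransf (F.P K) 0 (SU N)) (U : GaugeField (F.P K) 0 (SU N)) :
    InUkClassB11 F N K k ε₀ (GaugeField.gaugeAct u U) ↔ InUkClassB11 F N K k ε₀ U := by
  unfold InUkClassB11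
  rw [toUField_gaugeAct]
  exact B10Eq68TorusRegularity.inSpace_gaugeAct_iff _ _

/-! ## §5. The typed HOMES of GAPS row G₈a-3 (DISPLAYED, asserted nowhere), in both printed currencies -/

variable (F N)

/-- **NAME FOR THE STATEMENT OF GAPS ROW G₈a-3, [I] (1.2) FORM** (a `Prop`, asserted nowhere): «`U_k(V)` of ₈a satisfies the current clause of
(1.2)» for every `V` with `UkExists` (G₈a-1).  Print: [I] p. 260 «implied by the condition on V, with 2ε₀ replaced by B₃⁻¹ε₀, see Theorem 1 [15]» =
[B11] Thm 1 (8)–(10); its proof is NOT in the tree; ₈a's `bgReg`∕`Uk` untouched. [cite: Balaban1985Variational, Thm 1 (8)-(10) p.279] -/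
def UkCurrentSmall (K k : ℕ) (ε ε₀ : ℝ) : Prop :=
  ∀ V : GaugeField (F.P K) k (SU N), UkExists F N K k ε V → CurrentSmall F N K k ε₀ (Uk F N K k ε V)

/-- **NAME FOR THE STATEMENT OF GAPS ROW G₈a-3, [B11] (2)∕(8) FORM** (a `Prop`, asserted nowhere): Thm 1 (8) literally at `Ω_j = T` — the minimiser
of record lies in [B11] (2)'s full space with constant `ε₀`. [cite: Balaban1985Variational, Thm 1 (8) p.279] -/
def UkInSpaceB11 (K k : ℕ) (ε ε₀ : ℝ) : Prop :=
  ∀ V : GaugeField (F.P K) k (SU N), UkExists F N K k ε V → InUkClassB11 F N K k ε₀ (Uk F N K k ε V)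

/-- G₈a-3's (1.2)-form statement at `ε₀ = ε` ⇔ the minimiser of record lies in the FULL `U_k(ε)` whenever the problem is solvable (plaquette clause
= ₈a's `Uk_mem_bgReg`). [cite: Balaban1987RG1, (1.2) p.260 (bookkeeping)] -/
theorem ukCurrentSmall_iff_inUkClass (K k : ℕ) (ε : ℝ) :
    UkCurrentSmall F N K k ε ε ↔
      ∀ V : GaugeField (F.P K) k (SU N), UkExists F N K k ε V → InUkClass F N K k ε (Uk F N K k ε V) :=
  ⟨fun h V hV => ⟨Uk_mem_bgReg hV, h V hV⟩, fun h V hV => (h V hV).2⟩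

end Literature.MathematicalPhysics.QuantumFieldTheory.Balaban1983to89.Node00

end
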